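import Literature.AlgebraicGeometry.Resolution.FibreCone
import HarnessLib

/-!
# Functoriality of the Rees ring `𝒪[𝔭t]` and of the fibre cone `𝒪[𝔭t]/𝔫𝒪[𝔭t]` along ring homomorphisms

Topic: `Literature/AlgebraicGeometry/Resolution`. Companion of `FibreCone.lean` (the type synonym `ReesRing 𝔭` of
Mathlib's `reesAlgebra 𝔭 = 𝒪[𝔭t] ⊆ 𝒪[t]`, its homogeneous elements `ReesRing.tMonomial 𝔭 n x = x tⁿ`, the fibre cone
`FibreCone 𝔭 = 𝒪[𝔭t]/𝔫𝒪[𝔭t]` of a local ring `(𝒪, 𝔫)` and the structure map `fibreConeResidueMap 𝔭 : 𝒪/𝔫 → FibreCone 𝔭`).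
A ring homomorphism `f : 𝒪 → 𝒪'` with `f(𝔭) ⊆ 𝔭'` induces the graded map `𝒪[𝔭t] → 𝒪'[𝔭't]` (apply `f` to the
coefficients), and — for local `𝒪`, `𝒪'` and `f(𝔫) ⊆ 𝔫'` — a map of fibre cones; a ring isomorphism carrying `𝔭` onto
`𝔭'` induces isomorphisms. This is the standard functoriality of the Rees algebra and of the fibre `Proj` of a blowing up
(Eisenbud, *Commutative Algebra*, §5.2, the Rees algebra `R[It] ⊆ R[t]` "is functorial in the pair `(R, I)`"; Görtz–Wedhorn I,
(13.19) and Prop. 13.91 for the geometric side). PROVED here, no named facts (D-0026):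

* `ReesRing.map f h : ReesRing 𝔭 →+* ReesRing 𝔭'` for `h : 𝔭.map f ≤ 𝔭'`, with `poly_map` (coefficientwise `f`),
  `map_tMonomial` (`x tⁿ ↦ f(x) tⁿ`), `map_algebraMap` (`r ↦ f r` in degree `0`), `map_id_apply`, `map_map`;
* `ReesRing.mapEquiv e h : ReesRing 𝔭 ≃+* ReesRing 𝔭'` for a ring isomorphism `e` with `𝔭.map e = 𝔭'`;
* `map_reesMaxExt_le` — `𝔫𝒪[𝔭t]` is carried into `𝔫'𝒪'[𝔭't]` when `f(𝔫) ⊆ 𝔫'`;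
  `FibreCone.map f h hn : FibreCone 𝔭 →+* FibreCone 𝔭'` with `map_mk`, `map_fibreConeResidueMap_residue`;
* `FibreCone.mapEquiv e h : FibreCone 𝔭 ≃+* FibreCone 𝔭'` for a ring isomorphism of local rings with `𝔭.map e = 𝔭'`
  (then `𝔫.map e = 𝔫'` automatically), with `mapEquiv_mk`, `mapEquiv_apply`.

Consumer: the HIRONAKA-L lane library `Hironaka2017/Lib/EdgeDatumTransport.lean` (transport of Hironaka's edge algebra
`ν(℘(E)_ξ) ⊆ 𝒪[𝔫t]/𝔫𝒪[𝔫t]`, Def. 4.6 of the 2017 manuscript, along isomorphisms of local rings).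

## References

* D. Eisenbud, *Commutative Algebra with a View Toward Algebraic Geometry*, GTM 150, §5.2 (blowup algebra). [Eisenbud1995]
* U. Görtz, T. Wedhorn, *Algebraic Geometry I*, 2nd ed. (2020), (13.19), Prop. 13.91. [GortzWedhorn2020]
-/

noncomputable section

open Polynomial IsLocalRing

namespace Literature.AlgebraicGeometry.Resolution

universe u

variable {O O' O'' : Type u} [CommRing O] [CommRing O'] [CommRing O'']

namespace ReesRing

/-! ## The Rees ring along a ring homomorphism -/

/-- The coefficients of `(poly b).map f` lie in the powers of `𝔭'` when `f(𝔭) ⊆ 𝔭'`. [folklore] -/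
private theorem map_poly_mem (𝔭 : Ideal O) (𝔭' : Ideal O') (f : O →+* O') (h : 𝔭.map f ≤ 𝔭') (b : ReesRing 𝔭) :
    (poly 𝔭 b).map f ∈ reesAlgebra 𝔭' := by
  rw [mem_reesAlgebra_iff]
  intro i
  rw [Polynomial.coeff_map]
  have h1 : f ((poly 𝔭 b).coeff i) ∈ (𝔭 ^ i).map f := Ideal.mem_map_of_mem f (coeff_poly_mem 𝔭 b i)
  rw [Ideal.map_pow] at h1
  exact Ideal.pow_right_mono h i h1

/-- **The map `𝒪[𝔭t] → 𝒪'[𝔭't]` induced by a ring homomorphism `f : 𝒪 → 𝒪'` with `f(𝔭) ⊆ 𝔭'`** (apply `f` to the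
coefficients). [cite: Eisenbud1995, §5.2] -/
def map (𝔭 : Ideal O) (𝔭' : Ideal O') (f : O →+* O') (h : 𝔭.map f ≤ 𝔭') : ReesRing 𝔭 →+* ReesRing 𝔭' where
  toFun b := (equiv 𝔭').symm ⟨(poly 𝔭 b).map f, map_poly_mem 𝔭 𝔭' f h b⟩
  map_one' := ext 𝔭' (by
    change ((poly 𝔭 1).map f) = poly 𝔭' 1
    rw [poly_one, poly_one, Polynomial.map_one])
  map_mul' b c := ext 𝔭' (by
    change (poly 𝔭 (b * c)).map f = poly 𝔭' _
    rw [poly_mul, poly_mul, Polynomial.map_mul]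
    rfl)
  map_zero' := ext 𝔭' (by
    change ((poly 𝔭 0).map f) = poly 𝔭' 0
    rw [poly_zero, poly_zero, Polynomial.map_zero])
  map_add' b c := ext 𝔭' (by
    change (poly 𝔭 (b + c)).map f = poly 𝔭' _
    rw [poly_add, poly_add, Polynomial.map_add]
    rfl)

variable {𝔭 : Ideal O} {𝔭' : Ideal O'} {𝔭'' : Ideal O''}

/-- The polynomial of `map f b` is `(poly b).map f`. [cite: Eisenbud1995, §5.2] -/
@[simp] theorem poly_map (f : O →+* O') (h : 𝔭.map f ≤ 𝔭') (b : ReesRing 𝔭) :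
    poly 𝔭' (map 𝔭 𝔭' f h b) = (poly 𝔭 b).map f := rfl

/-- `map f (x tⁿ) = f(x) tⁿ`. [cite: Eisenbud1995, §5.2] -/
theorem map_tMonomial (f : O →+* O') (h : 𝔭.map f ≤ 𝔭') (n : ℕ) (x : O) (hx : x ∈ 𝔭 ^ n)
    (hx' : f x ∈ 𝔭' ^ n) :
    map 𝔭 𝔭' f h (tMonomial 𝔭 n x hx) = tMonomial 𝔭' n (f x) hx' :=
  ext 𝔭' (by rw [poly_map, poly_tMonomial, poly_tMonomial, Polynomial.map_monomial])

/-- The image of `x ∈ 𝔭ⁿ` lies in `𝔭'ⁿ` when `f(𝔭) ⊆ 𝔭'`. [cite: Eisenbud1995, §5.2] -/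
theorem mem_pow_of_mem_pow (f : O →+* O') (h : 𝔭.map f ≤ 𝔭') {n : ℕ} {x : O} (hx : x ∈ 𝔭 ^ n) :
    f x ∈ 𝔭' ^ n := by
  have h1 : f x ∈ (𝔭 ^ n).map f := Ideal.mem_map_of_mem f hx
  rw [Ideal.map_pow] at h1
  exact Ideal.pow_right_mono h n h1

/-- `map f (x tⁿ) = f(x) tⁿ`, with the membership proof supplied. [cite: Eisenbud1995, §5.2] -/
theorem map_tMonomial' (f : O →+* O') (h : 𝔭.map f ≤ 𝔭') (n : ℕ) (x : O) (hx : x ∈ 𝔭 ^ n) :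
    map 𝔭 𝔭' f h (tMonomial 𝔭 n x hx) = tMonomial 𝔭' n (f x) (mem_pow_of_mem_pow f h hx) :=
  map_tMonomial f h n x hx _

/-- `map f` on constants: `r ↦ f r`. [cite: Eisenbud1995, §5.2] -/
@[simp] theorem map_algebraMap (f : O →+* O') (h : 𝔭.map f ≤ 𝔭') (r : O) :
    map 𝔭 𝔭' f h (algebraMap O (ReesRing 𝔭) r) = algebraMap O' (ReesRing 𝔭') (f r) :=
  ext 𝔭' (by rw [poly_map, poly_algebraMap, poly_algebraMap, Polynomial.map_C])

/-- `map` of the identity is the identity. [cite: Eisenbud1995, §5.2] -/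
theorem map_id_apply (h : 𝔭.map (RingHom.id O) ≤ 𝔭) (b : ReesRing 𝔭) : map 𝔭 𝔭 (RingHom.id O) h b = b :=
  ext 𝔭 (by rw [poly_map, Polynomial.map_id])

/-- `map g ∘ map f = map (g ∘ f)`. [cite: Eisenbud1995, §5.2] -/
theorem map_map (f : O →+* O') (hf : 𝔭.map f ≤ 𝔭') (g : O' →+* O'') (hg : 𝔭'.map g ≤ 𝔭'')
    (hgf : 𝔭.map (g.comp f) ≤ 𝔭'') (b : ReesRing 𝔭) :
    map 𝔭' 𝔭'' g hg (map 𝔭 𝔭' f hf b) = map 𝔭 𝔭'' (g.comp f) hgf b :=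
  ext 𝔭'' (by rw [poly_map, poly_map, poly_map, Polynomial.map_map])

/-- For a ring isomorphism `e` with `𝔭.map e = 𝔭'`, the inverse carries `𝔭'` into `𝔭`. [cite: Eisenbud1995, §5.2] -/
theorem map_symm_le_of_map_eq (e : O ≃+* O') (h : 𝔭.map (e : O →+* O') = 𝔭') :
    𝔭'.map (e.symm : O' →+* O) ≤ 𝔭 := by
  rw [← h, Ideal.map_map]
  have : (e.symm : O' →+* O).comp (e : O →+* O') = RingHom.id O := by
    ext x; simp
  rw [this, Ideal.map_id]

/-- **The isomorphism `𝒪[𝔭t] ≅ 𝒪'[𝔭't]` induced by a ring isomorphism `e : 𝒪 ≅ 𝒪'` with `e(𝔭) = 𝔭'`.**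
[cite: Eisenbud1995, §5.2] -/
def mapEquiv (e : O ≃+* O') (h : 𝔭.map (e : O →+* O') = 𝔭') : ReesRing 𝔭 ≃+* ReesRing 𝔭' :=
  RingEquiv.ofRingHom (map 𝔭 𝔭' (e : O →+* O') h.le) (map 𝔭' 𝔭 (e.symm : O' →+* O) (map_symm_le_of_map_eq e h))
    (by
      refine RingHom.ext fun b => ext 𝔭' ?_
      rw [RingHom.comp_apply, poly_map, poly_map, Polynomial.map_map, RingHom.id_apply]
      have : (e : O →+* O').comp (e.symm : O' →+* O) = RingHom.id O' := by ext x; simp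
      rw [this, Polynomial.map_id])
    (by
      refine RingHom.ext fun b => ext 𝔭 ?_
      rw [RingHom.comp_apply, poly_map, poly_map, Polynomial.map_map, RingHom.id_apply]
      have : (e.symm : O' →+* O).comp (e : O →+* O') = RingHom.id O := by ext x; simp
      rw [this, Polynomial.map_id])

/-- `mapEquiv e` is `map e` on elements. [cite: Eisenbud1995, §5.2] -/
@[simp] theorem mapEquiv_apply (e : O ≃+* O') (h : 𝔭.map (e : O →+* O') = 𝔭') (b : ReesRing 𝔭) :
    mapEquiv e h b = map 𝔭 𝔭' (e : O →+* O') h.le b := rfl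

/-- The inverse of `mapEquiv e` is `map e⁻¹` on elements. [cite: Eisenbud1995, §5.2] -/
@[simp] theorem mapEquiv_symm_apply (e : O ≃+* O') (h : 𝔭.map (e : O →+* O') = 𝔭') (b : ReesRing 𝔭') :
    (mapEquiv e h).symm b = map 𝔭' 𝔭 (e.symm : O' →+* O) (map_symm_le_of_map_eq e h) b := rfl

/-- The polynomial of `mapEquiv e b`. [cite: Eisenbud1995, §5.2] -/
theorem poly_mapEquiv (e : O ≃+* O') (h : 𝔭.map (e : O →+* O') = 𝔭') (b : ReesRing 𝔭) :
    poly 𝔭' (mapEquiv e h b) = (poly 𝔭 b).map (e : O →+* O') := rfl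

end ReesRing

/-! ## The fibre cone along a homomorphism of local rings -/

section Cone

open ReesRing

variable [IsLocalRing O] [IsLocalRing O'] {𝔭 : Ideal O} {𝔭' : Ideal O'}

/-- `𝔫𝒪[𝔭t]` is carried into `𝔫'𝒪'[𝔭't]` by `map f` when `f(𝔫) ⊆ 𝔫'`. [cite: GortzWedhorn2020, Prop. 13.91] -/
theorem map_reesMaxExt_le (f : O →+* O') (h : 𝔭.map f ≤ 𝔭') (hn : (maximalIdeal O).map f ≤ maximalIdeal O') :
    (reesMaxExt 𝔭).map (ReesRing.map 𝔭 𝔭' f h) ≤ reesMaxExt 𝔭' := by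
  rw [reesMaxExt, Ideal.map_map, Ideal.map_le_iff_le_comap]
  intro r hr
  rw [Ideal.mem_comap, RingHom.comp_apply, ReesRing.map_algebraMap]
  exact Ideal.mem_map_of_mem _ (hn (Ideal.mem_map_of_mem f hr))

/-- **The map of fibre cones `𝒪[𝔭t]/𝔫𝒪[𝔭t] → 𝒪'[𝔭't]/𝔫'𝒪'[𝔭't]`** induced by a ring homomorphism `f : 𝒪 → 𝒪'` of
local rings with `f(𝔭) ⊆ 𝔭'` and `f(𝔫) ⊆ 𝔫'`. [cite: GortzWedhorn2020, Prop. 13.91] -/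
def FibreCone.map (f : O →+* O') (h : 𝔭.map f ≤ 𝔭') (hn : (maximalIdeal O).map f ≤ maximalIdeal O') :
    FibreCone 𝔭 →+* FibreCone 𝔭' :=
  Ideal.quotientMap (reesMaxExt 𝔭') (ReesRing.map 𝔭 𝔭' f h)
    (Ideal.map_le_iff_le_comap.mp (map_reesMaxExt_le f h hn))

/-- `FibreCone.map f` on classes. [cite: GortzWedhorn2020, Prop. 13.91] -/
@[simp] theorem FibreCone.map_mk (f : O →+* O') (h : 𝔭.map f ≤ 𝔭') (hn : (maximalIdeal O).map f ≤ maximalIdeal O')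
    (b : ReesRing 𝔭) :
    FibreCone.map f h hn (Ideal.Quotient.mk (reesMaxExt 𝔭) b) =
      Ideal.Quotient.mk (reesMaxExt 𝔭') (ReesRing.map 𝔭 𝔭' f h b) :=
  Ideal.quotientMap_mk

/-- `FibreCone.map f` on the residue field: `k → A` followed by the map is `k → k' → A'`. [cite: GortzWedhorn2020, Prop. 13.91] -/
theorem FibreCone.map_fibreConeResidueMap_residue (f : O →+* O') (h : 𝔭.map f ≤ 𝔭')
    (hn : (maximalIdeal O).map f ≤ maximalIdeal O') (r : O) :
    FibreCone.map f h hn (fibreConeResidueMap 𝔭 (residue O r)) = fibreConeResidueMap 𝔭' (residue O' (f r)) := by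
  rw [fibreConeResidueMap_residue, fibreConeResidueMap_residue, FibreCone.map_mk, ReesRing.map_algebraMap]

/-- For a ring isomorphism `e` with `𝔭.map e = 𝔭'`: `𝔫'𝒪'[𝔭't]` is the image of `𝔫𝒪[𝔭t]` under `mapEquiv e`.
[cite: GortzWedhorn2020, Prop. 13.91] -/
theorem reesMaxExt_eq_map_mapEquiv (e : O ≃+* O') (h : 𝔭.map (e : O →+* O') = 𝔭') :
    reesMaxExt 𝔭' = (reesMaxExt 𝔭).map (ReesRing.mapEquiv e h : ReesRing 𝔭 →+* ReesRing 𝔭') := by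
  have hn : (maximalIdeal O).map (e : O →+* O') = maximalIdeal O' := IsLocalRing.map_ringEquiv_maximalIdeal e
  apply le_antisymm
  · rw [reesMaxExt, Ideal.map_le_iff_le_comap]
    intro r' hr'
    rw [Ideal.mem_comap]
    have hr : e.symm r' ∈ maximalIdeal O := by
      rw [← IsLocalRing.map_ringEquiv_maximalIdeal e.symm]
      exact Ideal.mem_map_of_mem (e.symm : O' →+* O) hr'
    have h1 : algebraMap O' (ReesRing 𝔭') r' =
        ReesRing.mapEquiv e h (algebraMap O (ReesRing 𝔭) (e.symm r')) := by
      rw [ReesRing.mapEquiv_apply, ReesRing.map_algebraMap]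
      simp
    rw [h1]
    exact Ideal.mem_map_of_mem _ (Ideal.mem_map_of_mem _ hr)
  · have := map_reesMaxExt_le (𝔭 := 𝔭) (𝔭' := 𝔭') (e : O →+* O') h.le hn.le
    exact this

/-- **The isomorphism of fibre cones induced by an isomorphism of local rings `e : 𝒪 ≅ 𝒪'` with `e(𝔭) = 𝔭'`.**
[cite: GortzWedhorn2020, Prop. 13.91] -/
def FibreCone.mapEquiv (e : O ≃+* O') (h : 𝔭.map (e : O →+* O') = 𝔭') : FibreCone 𝔭 ≃+* FibreCone 𝔭' :=
  Ideal.quotientEquiv (reesMaxExt 𝔭) (reesMaxExt 𝔭') (ReesRing.mapEquiv e h) (reesMaxExt_eq_map_mapEquiv e h)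

/-- `FibreCone.mapEquiv e` on classes. [cite: GortzWedhorn2020, Prop. 13.91] -/
@[simp] theorem FibreCone.mapEquiv_mk (e : O ≃+* O') (h : 𝔭.map (e : O →+* O') = 𝔭') (b : ReesRing 𝔭) :
    FibreCone.mapEquiv e h (Ideal.Quotient.mk (reesMaxExt 𝔭) b) =
      Ideal.Quotient.mk (reesMaxExt 𝔭') (ReesRing.mapEquiv e h b) :=
  Ideal.quotientEquiv_mk _ _ _ _ b

/-- `FibreCone.mapEquiv e` agrees with `FibreCone.map e`. [cite: GortzWedhorn2020, Prop. 13.91] -/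
theorem FibreCone.mapEquiv_apply (e : O ≃+* O') (h : 𝔭.map (e : O →+* O') = 𝔭') (a : FibreCone 𝔭) :
    FibreCone.mapEquiv e h a =
      FibreCone.map (e : O →+* O') h.le (IsLocalRing.map_ringEquiv_maximalIdeal e).le a := by
  obtain ⟨b, rfl⟩ := Ideal.Quotient.mk_surjective a
  rw [FibreCone.mapEquiv_mk, FibreCone.map_mk, ReesRing.mapEquiv_apply]

/-- `FibreCone.mapEquiv e` on the residue field. [cite: GortzWedhorn2020, Prop. 13.91] -/
theorem FibreCone.mapEquiv_fibreConeResidueMap_residue (e : O ≃+* O') (h : 𝔭.map (e : O →+* O') = 𝔭') (r : O) :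
    FibreCone.mapEquiv e h (fibreConeResidueMap 𝔭 (residue O r)) = fibreConeResidueMap 𝔭' (residue O' (e r)) := by
  rw [FibreCone.mapEquiv_apply, FibreCone.map_fibreConeResidueMap_residue]
  rfl

end Cone

end Literature.AlgebraicGeometry.Resolution

end
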